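import Summits.Ventures.CertifiedManyBodySolver.Downfold.EmeryHarmonicLeverCert1B
import HarnessLib

/-!
# THE FIXED-HARMONIC LEVER: at every fixed value of the t′ harmonic `s(k) = (1 − cos k_x cos k_y)/2`, the velocity-matched one-band `t` of the σ three-band model is strictly LARGER at the
# lower Fermi energy — for EVERY pair of fillings (no face window: electron-like surfaces included), under `t_pp′ε < t_pd²`, `t_ppΔ ≤ 4t_pd²`, `t_pp ≤ |t_pd|`

Venture CertifiedManyBodySolver, cell `pub/hubbard-downfold` (stage S1; INFLATION-RULES-3to1-B §B.75 (f)), seat hubbard-downfold-mod-4 (technique B, g30); namespace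
`Summit.Ventures.CertifiedManyBodySolver.Downfold.Emery`. Sequel of `EmeryFermiScaleHarmonic` (`scaleT_eq_harmonic`: on a contour `t_eff(k; ε) = fsT²/(α + 8β·s(k))`) and of the certificates
`EmeryHarmonicLeverCert0A/B` (`harmLeverCert0`, 808 terms, `L₀ = 1000`; kit j339984) and `EmeryHarmonicLeverCert1A/B` (`harmLeverCert1`, 790 terms, `L₁ = 1152`; kit j339989). Everything PROVED
(0 sorry). WHAT THIS IS NOT: a statement about any material; `U = 0` one-body kinematics of the σ model as printed; the hypotheses `t_ppΔ ≤ 4t_pd²`, `t_pp ≤ |t_pd|` are a SUFFICIENT regime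
located by the certificate search.

* §1 The comparison `g(s) = fsT(ε₁)²·(α(ε₂) + 8β(ε₂)s) − fsT(ε₂)²·(α(ε₁) + 8β(ε₁)s)` is AFFINE in `s`; its two ends are certified: `harm0_cross_eq` (`s = 0`, the Γ harmonic: `L₀·g(0) = (ε₂−ε₁)·harmLeverCert0`)
  and `harm1_cross_eq` (`s = 1`, the `(π, 0)` harmonic: `L₁·g(1) = (ε₂−ε₁)·harmLeverCert1`), both by `ring` with `t_pp = c + h`, `m = t_pd² − t_pp′ε₂`.
* §2 **`harmonicLever`**: `Δ > 0`, `0 ≤ t_pp′ ≤ t_pp`, `t_pp² ≤ t_pd²`, `0 < ε₁ < ε₂`, `t_pp′ε₂ < t_pd²`, `t_ppΔ ≤ 4t_pd²` ⇒ for every `s ∈ [0, 1]`: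
  `fsT(ε₂)²·(α(ε₁) + 8β(ε₁)s) < fsT(ε₁)²·(α(ε₂) + 8β(ε₂)s)`, i.e. `T(s; ε₂) < T(s; ε₁)` for the harmonic scale `T(s; ε) = fsT²/(α + 8βs)` wherever its denominators are positive.
* §3 ON THE FERMI SURFACES (`scaleT_lt_of_tpHarm_eq`): two contour points, `k₁` at `ε₁` and `k₂` at `ε₂`, with the SAME harmonic `s(k₁) = s(k₂)` and positive energy denominators have
  `t_eff(k₂; ε₂) < t_eff(k₁; ε₁)` — hole doping RAISES the velocity-matched `t` at every fixed harmonic coordinate, at every filling; with the along-the-contour monotonicity of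
  `EmeryFermiScaleHarmonic` (sign of `β`): `scaleT_lt_of_tpHarm_le_of_beta_nonpos` (`β(ε₁) ≤ 0`, `s(k₂) ≤ s(k₁)`) and `scaleT_lt_of_tpHarm_ge_of_beta_nonneg` (`β(ε₁) ≥ 0`, `s(k₂) ≥ s(k₁)`).

Sources: three-band model [HybertsenSchluterChristensen1989, Eq. (1)]; [AndersenEtAl1995, §6]; Handelman certificates [folklore] (Handelman, Pacific J. Math. 132 (1988)).
-/

noncomputable section

namespace Summit.Ventures.CertifiedManyBodySolver.Downfold.Emery

open Real Set

/-! ## §1 The two endpoint identities -/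

set_option maxRecDepth 16384 in
/-- **THE Γ-END IDENTITY** (`s = 0`; `t_pp = c + h`, `ε₂ = ε₁ + d`, `m = t_pd² − c·ε₂`; scaled by `L₀ = 1000`): `L₀·(fsT₁²·α₂ − fsT₂²·α₁) = d·harmLeverCert0`. [folklore] -/
theorem harm0_cross_eq (Δ tpd c h ε₁ d : ℝ) :
    (1000 : ℝ) * (fsT Δ tpd (c + h) c ε₁ ^ 2 * scaleAlpha Δ tpd (c + h) c (ε₁ + d) - fsT Δ tpd (c + h) c (ε₁ + d) ^ 2 * scaleAlpha Δ tpd (c + h) c ε₁) =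
      d * harmLeverCert0 Δ ε₁ d c h (tpd ^ 2 - c * (ε₁ + d)) (4 * tpd ^ 2 - (c + h) * Δ) (tpd ^ 2 - (c + h) ^ 2) := by
  unfold scaleAlpha dfsT fsT fsD fsN cA dcA dfsD dfsN harmLeverCert0 harmLeverCert0P1 harmLeverCert0P2 harmLeverCert0P3 harmLeverCert0P4 harmLeverCert0P5 harmLeverCert0P6 harmLeverCert0P7 harmLeverCert0P8 harmLeverCert0P9 harmLeverCert0P10 harmLeverCert0P11 harmLeverCert0P12 harmLeverCert0P13 harmLeverCert0P14 harmLeverCert0P15 harmLeverCert0P16 harmLeverCert0P17 harmLeverCert0P18 harmLeverCert0P19 harmLeverCert0P20 harmLeverCert0P21 harmLeverCert0P22 harmLeverCert0P23 harmLeverCert0P24 harmLeverCert0P25 harmLeverCert0P26 harmLeverCert0P27 harmLeverCert0P28 harmLeverCert0P29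
  ring

set_option maxRecDepth 16384 in
/-- **THE (π, 0)-END IDENTITY** (`s = 1`; scaled by `L₁ = 1152`): `L₁·(fsT₁²·(α₂ + 8β₂) − fsT₂²·(α₁ + 8β₁)) = d·harmLeverCert1`. [folklore] -/
theorem harm1_cross_eq (Δ tpd c h ε₁ d : ℝ) :
    (1152 : ℝ) * (fsT Δ tpd (c + h) c ε₁ ^ 2 * (scaleAlpha Δ tpd (c + h) c (ε₁ + d) + 8 * scaleBeta Δ tpd (c + h) c (ε₁ + d))
        - fsT Δ tpd (c + h) c (ε₁ + d) ^ 2 * (scaleAlpha Δ tpd (c + h) c ε₁ + 8 * scaleBeta Δ tpd (c + h) c ε₁)) =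
      d * harmLeverCert1 Δ ε₁ d c h (tpd ^ 2 - c * (ε₁ + d)) (4 * tpd ^ 2 - (c + h) * Δ) (tpd ^ 2 - (c + h) ^ 2) := by
  unfold scaleAlpha scaleBeta dfsT fsT fsD fsN cA dcA dfsD dfsN harmLeverCert1 harmLeverCert1P1 harmLeverCert1P2 harmLeverCert1P3 harmLeverCert1P4 harmLeverCert1P5 harmLeverCert1P6 harmLeverCert1P7 harmLeverCert1P8 harmLeverCert1P9 harmLeverCert1P10 harmLeverCert1P11 harmLeverCert1P12 harmLeverCert1P13 harmLeverCert1P14 harmLeverCert1P15 harmLeverCert1P16 harmLeverCert1P17 harmLeverCert1P18 harmLeverCert1P19 harmLeverCert1P20 harmLeverCert1P21 harmLeverCert1P22 harmLeverCert1P23 harmLeverCert1P24 harmLeverCert1P25 harmLeverCert1P26 harmLeverCert1P27 harmLeverCert1P28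
  ring

/-! ## §2 The fixed-harmonic lever -/

/-- **THE FIXED-HARMONIC LEVER**: `Δ > 0`, `0 ≤ t_pp′ ≤ t_pp`, `t_pp² ≤ t_pd²`, `0 < ε₁ < ε₂`, `t_pp′ε₂ < t_pd²`, `t_ppΔ ≤ 4t_pd²` ⇒ for every `s ∈ [0, 1]`,
`fsT(ε₂)²·(α(ε₁) + 8β(ε₁)s) < fsT(ε₁)²·(α(ε₂) + 8β(ε₂)s)` (no face window, any filling). [folklore] -/
theorem harmonicLever {Δ tpd tpp c ε₁ ε₂ s : ℝ} (hΔ : 0 < Δ) (hc : 0 ≤ c) (hct : c ≤ tpp) (hp : tpp ^ 2 ≤ tpd ^ 2) (h1 : 0 < ε₁) (h12 : ε₁ < ε₂) (hm : c * ε₂ < tpd ^ 2)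
    (hq : tpp * Δ ≤ 4 * tpd ^ 2) (hs : s ∈ Set.Icc (0 : ℝ) 1) :
    fsT Δ tpd tpp c ε₂ ^ 2 * (scaleAlpha Δ tpd tpp c ε₁ + 8 * scaleBeta Δ tpd tpp c ε₁ * s) <
      fsT Δ tpd tpp c ε₁ ^ 2 * (scaleAlpha Δ tpd tpp c ε₂ + 8 * scaleBeta Δ tpd tpp c ε₂ * s) := by
  obtain ⟨d, rfl⟩ : ∃ d, ε₂ = ε₁ + d := ⟨ε₂ - ε₁, by ring⟩
  obtain ⟨h, rfl⟩ : ∃ h, tpp = c + h := ⟨tpp - c, by ring⟩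
  have hd : 0 < d := by linarith
  have hh : 0 ≤ h := by linarith
  have hQ : 0 ≤ 4 * tpd ^ 2 - (c + h) * Δ := by linarith
  have hP : 0 ≤ tpd ^ 2 - (c + h) ^ 2 := by linarith
  have hM : 0 < tpd ^ 2 - c * (ε₁ + d) := by linarith
  have hC0 := harmLeverCert0_pos (Δ := Δ) (ε₁ := ε₁) (d := d) (c := c) (h := h) (m := tpd ^ 2 - c * (ε₁ + d)) (Q := 4 * tpd ^ 2 - (c + h) * Δ) (P := tpd ^ 2 - (c + h) ^ 2)
    hΔ h1 hd.le hc hh hM hQ hP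
  have hC1 := harmLeverCert1_pos (Δ := Δ) (ε₁ := ε₁) (d := d) (c := c) (h := h) (m := tpd ^ 2 - c * (ε₁ + d)) (Q := 4 * tpd ^ 2 - (c + h) * Δ) (P := tpd ^ 2 - (c + h) ^ 2)
    hΔ h1 hd.le hc hh hM hQ hP
  have k0 := harm0_cross_eq Δ tpd c h ε₁ d
  have k1 := harm1_cross_eq Δ tpd c h ε₁ d
  set T₁ := fsT Δ tpd (c + h) c ε₁
  set T₂ := fsT Δ tpd (c + h) c (ε₁ + d)
  set A₁ := scaleAlpha Δ tpd (c + h) c ε₁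
  set A₂ := scaleAlpha Δ tpd (c + h) c (ε₁ + d)
  set B₁ := scaleBeta Δ tpd (c + h) c ε₁
  set B₂ := scaleBeta Δ tpd (c + h) c (ε₁ + d)
  -- the two ends
  have g0 : 0 < T₁ ^ 2 * A₂ - T₂ ^ 2 * A₁ := by
    have : 0 < (1000 : ℝ) * (T₁ ^ 2 * A₂ - T₂ ^ 2 * A₁) := by rw [k0]; exact mul_pos hd hC0
    exact pos_of_mul_pos_right this (by norm_num)
  have g1 : 0 < T₁ ^ 2 * (A₂ + 8 * B₂) - T₂ ^ 2 * (A₁ + 8 * B₁) := by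
    have : 0 < (1152 : ℝ) * (T₁ ^ 2 * (A₂ + 8 * B₂) - T₂ ^ 2 * (A₁ + 8 * B₁)) := by rw [k1]; exact mul_pos hd hC1
    exact pos_of_mul_pos_right this (by norm_num)
  -- affine interpolation in s
  obtain ⟨hs0, hs1⟩ := hs
  have e : T₁ ^ 2 * (A₂ + 8 * B₂ * s) - T₂ ^ 2 * (A₁ + 8 * B₁ * s) = (1 - s) * (T₁ ^ 2 * A₂ - T₂ ^ 2 * A₁) + s * (T₁ ^ 2 * (A₂ + 8 * B₂) - T₂ ^ 2 * (A₁ + 8 * B₁)) := by ring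
  have hpos : 0 < (1 - s) * (T₁ ^ 2 * A₂ - T₂ ^ 2 * A₁) + s * (T₁ ^ 2 * (A₂ + 8 * B₂) - T₂ ^ 2 * (A₁ + 8 * B₁)) := by
    rcases lt_or_ge s (1 / 2) with hlt | hge
    · have : 0 < (1 - s) * (T₁ ^ 2 * A₂ - T₂ ^ 2 * A₁) := mul_pos (by linarith) g0
      have : 0 ≤ s * (T₁ ^ 2 * (A₂ + 8 * B₂) - T₂ ^ 2 * (A₁ + 8 * B₁)) := mul_nonneg hs0 g1.le
      linarith
    · have : 0 ≤ (1 - s) * (T₁ ^ 2 * A₂ - T₂ ^ 2 * A₁) := mul_nonneg (by linarith) g0.le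
      have : 0 < s * (T₁ ^ 2 * (A₂ + 8 * B₂) - T₂ ^ 2 * (A₁ + 8 * B₁)) := mul_pos (by linarith) g1
      linarith
  linarith [e ▸ hpos]

/-- The harmonic scale `T(s; ε) = fsT²/(α + 8βs)` is strictly larger at the lower Fermi energy whenever both denominators are positive (same hypotheses). [folklore] -/
theorem harmonicScale_strictAnti {Δ tpd tpp c ε₁ ε₂ s : ℝ} (hΔ : 0 < Δ) (hc : 0 ≤ c) (hct : c ≤ tpp) (hp : tpp ^ 2 ≤ tpd ^ 2) (h1 : 0 < ε₁) (h12 : ε₁ < ε₂) (hm : c * ε₂ < tpd ^ 2)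
    (hq : tpp * Δ ≤ 4 * tpd ^ 2) (hs : s ∈ Set.Icc (0 : ℝ) 1) (hD₁ : 0 < scaleAlpha Δ tpd tpp c ε₁ + 8 * scaleBeta Δ tpd tpp c ε₁ * s)
    (hD₂ : 0 < scaleAlpha Δ tpd tpp c ε₂ + 8 * scaleBeta Δ tpd tpp c ε₂ * s) :
    fsT Δ tpd tpp c ε₂ ^ 2 / (scaleAlpha Δ tpd tpp c ε₂ + 8 * scaleBeta Δ tpd tpp c ε₂ * s) <
      fsT Δ tpd tpp c ε₁ ^ 2 / (scaleAlpha Δ tpd tpp c ε₁ + 8 * scaleBeta Δ tpd tpp c ε₁ * s) := by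
  rw [div_lt_div_iff₀ hD₂ hD₁]
  exact harmonicLever hΔ hc hct hp h1 h12 hm hq hs

/-! ## §3 On the Fermi surfaces -/

/-- **HOLE DOPING RAISES `t_eff` AT EVERY FIXED HARMONIC COORDINATE**: contour points `(x₁, y₁)` at `ε₁` and `(x₂, y₂)` at `ε₂ > ε₁` (zone points) with `s(x₂, y₂) = s(x₁, y₁)`, positive
`fsT` and energy denominators ⇒ `t_eff(k₂; ε₂) < t_eff(k₁; ε₁)` (regime as in `harmonicLever`). [folklore] -/
theorem scaleT_lt_of_tpHarm_eq {Δ tpd tpp c ε₁ ε₂ x₁ y₁ x₂ y₂ : ℝ} (hΔ : 0 < Δ) (hc : 0 ≤ c) (hct : c ≤ tpp) (hp : tpp ^ 2 ≤ tpd ^ 2) (h1 : 0 < ε₁) (h12 : ε₁ < ε₂)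
    (hm : c * ε₂ < tpd ^ 2) (hq : tpp * Δ ≤ 4 * tpd ^ 2) (hx₁ : x₁ ∈ Set.Icc (0 : ℝ) 1) (hy₁ : y₁ ∈ Set.Icc (0 : ℝ) 1)
    (hP₁ : charCubic Δ tpd tpp c x₁ y₁ ε₁ = 0) (hP₂ : charCubic Δ tpd tpp c x₂ y₂ ε₂ = 0) (hT₁ : 0 < fsT Δ tpd tpp c ε₁) (hT₂ : 0 < fsT Δ tpd tpp c ε₂)
    (hW₁ : 0 < dcharCubic Δ tpd tpp c x₁ y₁ ε₁) (hW₂ : 0 < dcharCubic Δ tpd tpp c x₂ y₂ ε₂) (hs : tpHarm x₂ y₂ = tpHarm x₁ y₁) :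
    scaleT Δ tpd tpp c x₂ y₂ ε₂ < scaleT Δ tpd tpp c x₁ y₁ ε₁ := by
  have e1 := fsT_mul_dcharCubic_of_contour hP₁
  have e2 := fsT_mul_dcharCubic_of_contour hP₂
  have hD₁ : 0 < scaleAlpha Δ tpd tpp c ε₁ + 8 * scaleBeta Δ tpd tpp c ε₁ * tpHarm x₁ y₁ := by rw [← e1]; exact mul_pos hT₁ hW₁
  have hD₂ : 0 < scaleAlpha Δ tpd tpp c ε₂ + 8 * scaleBeta Δ tpd tpp c ε₂ * tpHarm x₁ y₁ := by rw [← hs, ← e2]; exact mul_pos hT₂ hW₂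
  rw [scaleT_eq_harmonic hP₁ hT₁.ne', scaleT_eq_harmonic hP₂ hT₂.ne', hs]
  exact harmonicScale_strictAnti hΔ hc hct hp h1 h12 hm hq (tpHarm_mem_Icc hx₁ hy₁) hD₁ hD₂

/-- With `β(ε₁) ≤ 0` (hole doping raises the contour's `|t′/t|` at the lower level) the lever extends to every `ε₂`-point whose harmonic is NOT LARGER than that of the `ε₁`-point:
`s(k₂) ≤ s(k₁)` ⇒ `t_eff(k₂; ε₂) < t_eff(k₁; ε₁)`. [folklore] -/
theorem scaleT_lt_of_tpHarm_le_of_beta_nonpos {Δ tpd tpp c ε₁ ε₂ x₁ y₁ x₂ y₂ : ℝ} (hΔ : 0 < Δ) (hc : 0 ≤ c) (hct : c ≤ tpp) (hp : tpp ^ 2 ≤ tpd ^ 2) (h1 : 0 < ε₁)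
    (h12 : ε₁ < ε₂) (hm : c * ε₂ < tpd ^ 2) (hq : tpp * Δ ≤ 4 * tpd ^ 2) (hx₂ : x₂ ∈ Set.Icc (0 : ℝ) 1) (hy₂ : y₂ ∈ Set.Icc (0 : ℝ) 1)
    (hP₁ : charCubic Δ tpd tpp c x₁ y₁ ε₁ = 0) (hP₂ : charCubic Δ tpd tpp c x₂ y₂ ε₂ = 0) (hT₁ : 0 < fsT Δ tpd tpp c ε₁) (hT₂ : 0 < fsT Δ tpd tpp c ε₂)
    (hW₁ : 0 < dcharCubic Δ tpd tpp c x₁ y₁ ε₁) (hW₂ : 0 < dcharCubic Δ tpd tpp c x₂ y₂ ε₂) (hβ : scaleBeta Δ tpd tpp c ε₁ ≤ 0) (hs : tpHarm x₂ y₂ ≤ tpHarm x₁ y₁) :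
    scaleT Δ tpd tpp c x₂ y₂ ε₂ < scaleT Δ tpd tpp c x₁ y₁ ε₁ := by
  have e1 := fsT_mul_dcharCubic_of_contour hP₁
  have e2 := fsT_mul_dcharCubic_of_contour hP₂
  have hD₁ : 0 < scaleAlpha Δ tpd tpp c ε₁ + 8 * scaleBeta Δ tpd tpp c ε₁ * tpHarm x₁ y₁ := by rw [← e1]; exact mul_pos hT₁ hW₁
  have hD₂ : 0 < scaleAlpha Δ tpd tpp c ε₂ + 8 * scaleBeta Δ tpd tpp c ε₂ * tpHarm x₂ y₂ := by rw [← e2]; exact mul_pos hT₂ hW₂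
  -- at the harmonic s₂ of the ε₂-point: T(s₂; ε₂) < T(s₂; ε₁) ≤ T(s₁; ε₁)
  have hD₁' : 0 < scaleAlpha Δ tpd tpp c ε₁ + 8 * scaleBeta Δ tpd tpp c ε₁ * tpHarm x₂ y₂ := by nlinarith [mul_le_mul_of_nonpos_left hs hβ]
  have step1 := harmonicScale_strictAnti hΔ hc hct hp h1 h12 hm hq (tpHarm_mem_Icc hx₂ hy₂) hD₁' hD₂
  have step2 : fsT Δ tpd tpp c ε₁ ^ 2 / (scaleAlpha Δ tpd tpp c ε₁ + 8 * scaleBeta Δ tpd tpp c ε₁ * tpHarm x₂ y₂) ≤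
      fsT Δ tpd tpp c ε₁ ^ 2 / (scaleAlpha Δ tpd tpp c ε₁ + 8 * scaleBeta Δ tpd tpp c ε₁ * tpHarm x₁ y₁) :=
    div_le_div_of_nonneg_left (by positivity) hD₁ (by nlinarith [mul_le_mul_of_nonpos_left hs hβ])
  rw [scaleT_eq_harmonic hP₁ hT₁.ne', scaleT_eq_harmonic hP₂ hT₂.ne']
  exact lt_of_lt_of_le step1 step2

/-- With `β(ε₁) ≥ 0` the lever extends to every `ε₂`-point whose harmonic is NOT SMALLER: `s(k₂) ≥ s(k₁)` ⇒ `t_eff(k₂; ε₂) < t_eff(k₁; ε₁)`. [folklore] -/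
theorem scaleT_lt_of_tpHarm_ge_of_beta_nonneg {Δ tpd tpp c ε₁ ε₂ x₁ y₁ x₂ y₂ : ℝ} (hΔ : 0 < Δ) (hc : 0 ≤ c) (hct : c ≤ tpp) (hp : tpp ^ 2 ≤ tpd ^ 2) (h1 : 0 < ε₁)
    (h12 : ε₁ < ε₂) (hm : c * ε₂ < tpd ^ 2) (hq : tpp * Δ ≤ 4 * tpd ^ 2) (hx₂ : x₂ ∈ Set.Icc (0 : ℝ) 1) (hy₂ : y₂ ∈ Set.Icc (0 : ℝ) 1)
    (hP₁ : charCubic Δ tpd tpp c x₁ y₁ ε₁ = 0) (hP₂ : charCubic Δ tpd tpp c x₂ y₂ ε₂ = 0) (hT₁ : 0 < fsT Δ tpd tpp c ε₁) (hT₂ : 0 < fsT Δ tpd tpp c ε₂)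
    (hW₁ : 0 < dcharCubic Δ tpd tpp c x₁ y₁ ε₁) (hW₂ : 0 < dcharCubic Δ tpd tpp c x₂ y₂ ε₂) (hβ : 0 ≤ scaleBeta Δ tpd tpp c ε₁) (hs : tpHarm x₁ y₁ ≤ tpHarm x₂ y₂) :
    scaleT Δ tpd tpp c x₂ y₂ ε₂ < scaleT Δ tpd tpp c x₁ y₁ ε₁ := by
  have e1 := fsT_mul_dcharCubic_of_contour hP₁
  have e2 := fsT_mul_dcharCubic_of_contour hP₂
  have hD₁ : 0 < scaleAlpha Δ tpd tpp c ε₁ + 8 * scaleBeta Δ tpd tpp c ε₁ * tpHarm x₁ y₁ := by rw [← e1]; exact mul_pos hT₁ hW₁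
  have hD₂ : 0 < scaleAlpha Δ tpd tpp c ε₂ + 8 * scaleBeta Δ tpd tpp c ε₂ * tpHarm x₂ y₂ := by rw [← e2]; exact mul_pos hT₂ hW₂
  have hD₁' : 0 < scaleAlpha Δ tpd tpp c ε₁ + 8 * scaleBeta Δ tpd tpp c ε₁ * tpHarm x₂ y₂ := by nlinarith [mul_le_mul_of_nonneg_left hs hβ]
  have step1 := harmonicScale_strictAnti hΔ hc hct hp h1 h12 hm hq (tpHarm_mem_Icc hx₂ hy₂) hD₁' hD₂
  have step2 : fsT Δ tpd tpp c ε₁ ^ 2 / (scaleAlpha Δ tpd tpp c ε₁ + 8 * scaleBeta Δ tpd tpp c ε₁ * tpHarm x₂ y₂) ≤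
      fsT Δ tpd tpp c ε₁ ^ 2 / (scaleAlpha Δ tpd tpp c ε₁ + 8 * scaleBeta Δ tpd tpp c ε₁ * tpHarm x₁ y₁) :=
    div_le_div_of_nonneg_left (by positivity) hD₁ (by nlinarith [mul_le_mul_of_nonneg_left hs hβ])
  rw [scaleT_eq_harmonic hP₁ hT₁.ne', scaleT_eq_harmonic hP₂ hT₂.ne']
  exact lt_of_lt_of_le step1 step2

end Summit.Ventures.CertifiedManyBodySolver.Downfold.Emery
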